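import Summits.QuantumFields.YangMills.Theorems.UnitScaleTiltProp7StubEXOfDisplayedRowsW
import Summits.QuantumFields.YangMills.Theorems.UnitScaleTiltProp7CminOfP6T3PdG
import Summits.QuantumFields.YangMills.Theorems.UnitScaleTiltProp7ExistRouteAlphaMinG
import HarnessLib

/-!
# Route `UnitScaleTilt`, crux K1 child «MinimiserStabilityRegPr» (stmt-QuantumFields-19200), skeleton v10, stub `stub_existenceMinimalOrbit` (EX), route (α) — **THE (α-S) DEPMAP
# WITH THE WINDOWED (1.37)-BINDER, (21)-LETTER GENERIC (display place (d), ★★OWNER ACK 34 (1); knit ruler's plan ≈09:34Z): the MINIMISER-side (21) is an ARBITRARY predicate `Lan` (the knit instantiates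
# `IsLandauPrintS … (c₀ L) (cB L) U₀`); the competitor binder keeps print's `IsLandauPrint` (lit `Thm2TorusAt` via ✓`cov_of_thm2TorusAt`); (21) is never unfolded here — otherwise ✓`Prop7StubEXOfDisplayedRowsWS` (= the instance `Lan := IsLandauPrint`)** (★★OWNER RULING g26-№19 «(α-S) ADOPTED — `AvgCondPrintS` (SYMMETRIC
# slice Σ_kˢ, explicit witness `ũ_S`); print's comb slice `AvgCondPrint` leaves the EX DISPLAY»; ORDER (2)(iii) «`…StubEXOfDisplayedRowsWS` mechanical copy»; knit ruler's letter plan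
# (J1): the MINIMISER's (20) and the growth row's witnesses are re-based (`AvgCondPrintS`, `NormS`), the COMPETITOR binder keeps print's comb (20) — supplied by COV from
# [Balaban1985RegularSpaces] Thm 2 (lit `Thm2TorusAt`) verbatim, no bridge)

Cell `ym3-torus`, width seat `ym-ust-19200-w2` (gen 3; EX KNIT RULER, RULING g26-№19 ORDER (2) file F3).  THEOREMS ONLY (0 `def`, 0 `sorry`).  By-name bookkeeping: nothing here
closes the stub; `--supports stmt-QuantumFields-19200 --as helper`, count-neutral.  YM₃ on T³ is a ladder rung (R3), not the Clay problem; nothing here claims the stub, the crux,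
d = 4 or the mass gap.

THE PRINT.  [Balaban1985Variational] p. 299 Prop. 7 («U₁ … is a unique minimum of the functional A(U₁U₀) on the space (6)»), p. 281 (19)–(21), (14) p. 280; [Balaban1985RegularSpaces]
(1.28)–(1.30) p. 81 (the slice), (1.37) p. 82 («hence |B| < 2dLC₁ε₁» — asked only where the composition invokes it: `L³B₃ε₁ ≤ α`), Thm 2 p. 83 (COV); [Balaban1985Averaging] (87)
p. 31 (the witness' top-centre values — here the SYMMETRIC accumulated frames `(w^{sym}_{iX})⁻¹` of the chart of record, `Prop7SPrint.NormS`).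

WHAT IS PROVED.  §1 ★ **`Cmin_of_P6T3_chart_growth_pd_wG`** — ✓`Cmin_of_P6T3_chart_growth_pd_S` with the `bound20` binder windowed (`… → (L:ℝ)^3·B₃·ε₁ ≤ α → ‖Bf i V U₀‖ < …`).
§2 ★★ **`stubEX_of_displayedRows_wG`** ((21)-letter generic: `Lan L i U₀ X` on the minimiser side) — the REGISTERED text of `stub_existenceMinimalOrbit` (all `L > 1`, all `B₃ > 4`) from the displayed rows {N06(d = 3) ×2, Prop. 4, (B20)
windowed at `B₃* = 3L`, CHART-112ˢ, (γ)-growthˢ, T2 = lit `Thm2TorusAt`}; composition ✓`cov_of_thm2TorusAt` ∘ §1 ∘ ✓`existenceMinimalOrbit_of_CminS_cov` ∘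
✓`existenceMinimalOrbit_allB₃_of_one`.  HONEST SCOPE: by-name bookkeeping; every analytic input stays a displayed row; no corollary of the stub is restated.

References: T. Bałaban, CMP 102 (1985) 277–309 [Balaban1985Variational] ((14) p.280, (19)–(21) p.281, (103) p.293, (111)–(112) p.294, Props 5–7 pp.294–299, (141)–(142) p.299);
CMP 99 (1985) 75–102 [Balaban1985RegularSpaces] ((1.19) p.79, (1.28)–(1.30) p.81, (1.37) p.82, Thm 2 p.83); CMP 99 (1985) 389–434 [Balaban1985BackgroundPropagators] (Thms 3.12–3.13);
CMP 98 (1985) 17–51 [Balaban1985Averaging] ((87) p.31).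
-/

set_option autoImplicit false

noncomputable section

open scoped BigOperators Matrix.Norms.L2Operator Matrix

namespace Summit.QuantumFields.YangMills.Theorems.Prop7StubEXOfDisplayedRowsWG

open Literature.MathematicalPhysics.QuantumFieldTheory.Balaban1983to89
open Literature.MathematicalPhysics.QuantumFieldTheory.Balaban1983to89.T3ContinuumYM3Torus
open Literature.MathematicalPhysics.QuantumFieldTheory.Balaban1983to89.T3UnitLawDensityEML (ℰp)
open Literature.MathematicalPhysics.QuantumFieldTheory.Balaban1983to89.T3ConstrainedMinimiser (fibre)
open Literature.MathematicalPhysics.QuantumFieldTheory.Balaban1983to89.T3PrintedRegularMinimiser (RegPr regFibrePr)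
open Literature.MathematicalPhysics.QuantumFieldTheory.Balaban1983to89.T3PrintedRegularOrbits (descTransf)
open Literature.MathematicalPhysics.QuantumFieldTheory.Balaban1983to89.T3Thm1Carrier
open Literature.MathematicalPhysics.QuantumFieldTheory.Balaban1983to89.T3SectALandauChart (In19 emb15 CloseAvg eta)
open BlockAveragingEMLLinearisedBackground (pertVar)
open B4Sect5Torus (TSite)
open B9SectCLatticeCarrier (Bond)
open B10Eq27TorusAxialLog (unitsField toUField)
open B11Eq115Space (NegSize Space115)
open B11Eq111FrakG (nabla115)
open B11Eq98CurrentSlot (Jcur)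
open B13Contraction113 (QuadAnalytic)
open B8Thm2TorusAt (Thm2TorusAt)
open B7Prop2SpecialUnitary (specialUnitaryUnits)
open Summit.QuantumFields.YangMills.Theorems.Prop7TPrint (nMax19 expHermField)
open Summit.QuantumFields.YangMills.Theorems.Prop7SPrint (AvgCondPrint AvgCondPrintS NormS IsLandauPrint)
open Summit.QuantumFields.YangMills.Theorems.Prop7CminOfP6T3PdG (Cmin_of_P6T3_chart_growth_pd_G)
open Summit.QuantumFields.YangMills.Theorems.Prop7CovOfThm2 (cov_of_thm2TorusAt)
open Summit.QuantumFields.YangMills.Theorems.Prop7ExistRouteAlphaMinG (existenceMinimalOrbit_of_CminG_cov)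
open Summit.QuantumFields.YangMills.Theorems.Prop7ClosedFibreHalving (existenceMinimalOrbit_allB₃_of_one)

/-! ## §1 C-minˢ at `(L, B₃)` with the WINDOWED (1.37)-binder — from ✓`Cmin_of_P6T3_chart_growth_pd_S` at the windowed letter `Bf′` -/

variable {L : ℕ}

/-- ★ **C-minˢ FROM PROPOSITION 6 AT THE T³ OBJECTS, CHART-112ˢ, GROWTH — (B20) WINDOWED, (21)-LETTER GENERIC**: ✓`Prop7CminOfP6T3PdG.Cmin_of_P6T3_chart_growth_pd_G`'s statement VERBATIM
except the `bound20` binder, which carries the admissibility window `(L:ℝ)^3·B₃·ε₁ ≤ α` (the (α-S) twin of ✓`Cmin_of_P6T3_chart_growth_pd_w`; same proof: the windowed letter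
`Bf′ := if admissible then Bf else 0` satisfies the un-windowed row, and CHART-112ˢ's own window makes the `if` true).  Letters: `hChart` (20) conjunct = `AvgCondPrintS`, E–L clause and
`hGrowth` witnesses = `NormS U₀ X (e^{iX}) u`; conclusion: minimiser `AvgCondPrintS`, competitors print's `AvgCondPrint`.
[cite: Balaban1985Variational, Prop. 6 p.295, (112) p.294, (141)-(142) p.299, (19)-(21) p.281; Balaban1985RegularSpaces, (1.37) p.82, (1.28)-(1.30) p.81; Balaban1985Averaging, (87) p.31] -/
theorem Cmin_of_P6T3_chart_growth_pd_wG (hL : 1 < L) {B₃ : ℝ} (hB₃ : 3 * (L : ℝ) ≤ B₃)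
    [hFL : ∀ F : T3Family, Fact (0 < (F.L : ℝ))] [hFη : ∀ (F : T3Family) (k : ℕ), Fact (0 < ((F.L : ℝ)⁻¹) ^ k)]
    (Lan : ∀ i : Idx L, GaugeField (i.1.1.P i.1.2.2) 0 (Matrix.specialUnitaryGroup (Fin 2) ℂ) → (PBond (i.1.1.P i.1.2.2) 0 → Matrix (Fin 2) (Fin 2) ℂ) → Prop)
    -- the lattice periods and the site charts, ABSTRACT (periodsT3 ∕ towerP are instances)
    (Pd : ∀ i : Idx L, Fin (i.1.1.P i.1.2.2).d → ℕ) (e : ∀ i : Idx L, Site (i.1.1.P i.1.2.2) 0 ≃ TSite (i.1.1.P i.1.2.2).d (Pd i))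
    (he : ∀ (i : Idx L) (x : Site (i.1.1.P i.1.2.2) 0) (μ : Fin (i.1.1.P i.1.2.2).d), e i (x.shift μ) = B9Eq33CovDerivVector.shiftEquiv μ (e i x))
    {B₀ C₄ a₃ α r M CP θ cS : ℝ} (hB₀ : 0 < B₀) (hC₄ : 0 < C₄) (ha₃ : 0 < a₃) (hα : 0 < α) (hr : 0 < r) (hM : 0 < M) (hCP : 0 < CP) (hθ : θ < 1 / 2)
    (hcS : 0 ≤ cS)
    -- the curved letters, OPAQUE
    (𝒢f : ∀ (i : Idx L) (U₀ : GaugeField (i.1.1.P i.1.2.2) 0 (Matrix.specialUnitaryGroup (Fin 2) ℂ)),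
      NegSize (i.1.1.L : ℝ) (((i.1.1.L : ℝ)⁻¹) ^ (i.1.2.2 - i.1.2.1)) (fun _ : Bond (i.1.1.P i.1.2.2).d (Pd i) => i.1.2.2 - i.1.2.1) 3
          (Matrix (Fin 2) (Fin 2) ℂ) →L[ℂ]
        Space115 (i.1.1.L : ℝ) (((i.1.1.L : ℝ)⁻¹) ^ (i.1.2.2 - i.1.2.1)) (fun _ : Bond (i.1.1.P i.1.2.2).d (Pd i) => i.1.2.2 - i.1.2.1)
          (fun _ : Bond (i.1.1.P i.1.2.2).d (Pd i) × Fin (i.1.1.P i.1.2.2).d => i.1.2.2 - i.1.2.1) (nabla115 (((i.1.1.L : ℝ)⁻¹) ^ (i.1.2.2 - i.1.2.1)) (fun b : Bond (i.1.1.P i.1.2.2).d (Pd i) => unitsField (toUField U₀) ⟨(e i).symm b.1, b.2⟩)))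
    (Wf : ∀ (i : Idx L) (U₀ : GaugeField (i.1.1.P i.1.2.2) 0 (Matrix.specialUnitaryGroup (Fin 2) ℂ)),
      Space115 (i.1.1.L : ℝ) (((i.1.1.L : ℝ)⁻¹) ^ (i.1.2.2 - i.1.2.1)) (fun _ : Bond (i.1.1.P i.1.2.2).d (Pd i) => i.1.2.2 - i.1.2.1)
          (fun _ : Bond (i.1.1.P i.1.2.2).d (Pd i) × Fin (i.1.1.P i.1.2.2).d => i.1.2.2 - i.1.2.1) (nabla115 (((i.1.1.L : ℝ)⁻¹) ^ (i.1.2.2 - i.1.2.1)) (fun b : Bond (i.1.1.P i.1.2.2).d (Pd i) => unitsField (toUField U₀) ⟨(e i).symm b.1, b.2⟩)) →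
        NegSize (i.1.1.L : ℝ) (((i.1.1.L : ℝ)⁻¹) ^ (i.1.2.2 - i.1.2.1)) (fun _ : Bond (i.1.1.P i.1.2.2).d (Pd i) => i.1.2.2 - i.1.2.1) 3 (Matrix (Fin 2) (Fin 2) ℂ))
    (β : Idx L → Type) [∀ i, Fintype (β i)]
    (H₁f : ∀ (i : Idx L) (U₀ : GaugeField (i.1.1.P i.1.2.2) 0 (Matrix.specialUnitaryGroup (Fin 2) ℂ)),
      (β i → Matrix (Fin 2) (Fin 2) ℂ) →L[ℂ]
        Space115 (i.1.1.L : ℝ) (((i.1.1.L : ℝ)⁻¹) ^ (i.1.2.2 - i.1.2.1)) (fun _ : Bond (i.1.1.P i.1.2.2).d (Pd i) => i.1.2.2 - i.1.2.1)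
          (fun _ : Bond (i.1.1.P i.1.2.2).d (Pd i) × Fin (i.1.1.P i.1.2.2).d => i.1.2.2 - i.1.2.1) (nabla115 (((i.1.1.L : ℝ)⁻¹) ^ (i.1.2.2 - i.1.2.1)) (fun b : Bond (i.1.1.P i.1.2.2).d (Pd i) => unitsField (toUField U₀) ⟨(e i).symm b.1, b.2⟩)))
    (Bf : ∀ (i : Idx L), GaugeField (i.1.1.P i.1.2.1) 0 (Matrix.specialUnitaryGroup (Fin 2) ℂ) → GaugeField (i.1.1.P i.1.2.2) 0 (Matrix.specialUnitaryGroup (Fin 2) ℂ) →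
      β i → Matrix (Fin 2) (Fin 2) ℂ)
    -- their displayed bounds (the `SectEDatum` fields at admissible backgrounds)
    (norm_G : ∀ (i : Idx L) (e : ℝ) (U₀ : GaugeField (i.1.1.P i.1.2.2) 0 (Matrix.specialUnitaryGroup (Fin 2) ℂ)),
      RegPr i.1.1 i.1.2.1 i.1.2.2 e U₀ → e ≤ α → ∀ f, ‖𝒢f i U₀ f‖ ≤ B₀ * ‖f‖)
    (prop4 : ∀ (i : Idx L) (e : ℝ) (U₀ : GaugeField (i.1.1.P i.1.2.2) 0 (Matrix.specialUnitaryGroup (Fin 2) ℂ)),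
      RegPr i.1.1 i.1.2.1 i.1.2.2 e U₀ → e ≤ α → QuadAnalytic (Wf i U₀) C₄ a₃)
    (norm_H₁ : ∀ (i : Idx L) (e : ℝ) (U₀ : GaugeField (i.1.1.P i.1.2.2) 0 (Matrix.specialUnitaryGroup (Fin 2) ℂ)),
      RegPr i.1.1 i.1.2.1 i.1.2.2 e U₀ → e ≤ α → ∀ b, ‖H₁f i U₀ b‖ ≤ B₀ * ‖b‖)
    -- (B20), WINDOWED: «The configurations U₀, V satisfy (14), hence |B| < 2dLC₁ε₁» — asked only on the admissible class `L³B₃ε₁ ≤ α`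
    (bound20 : ∀ (i : Idx L) (ε₁ : ℝ) (V : GaugeField (i.1.1.P i.1.2.1) 0 (Matrix.specialUnitaryGroup (Fin 2) ℂ))
      (U₀ : GaugeField (i.1.1.P i.1.2.2) 0 (Matrix.specialUnitaryGroup (Fin 2) ℂ)), 0 < ε₁ → PlaqSmall ε₁ V →
      RegPr i.1.1 i.1.2.1 i.1.2.2 ((L : ℝ) ^ 3 * B₃ * ε₁) U₀ → CloseAvg i.1.1 i.1.2.1 i.1.2.2 i.2.2.le ((L : ℝ) ^ 3 * ε₁) V U₀ → (L : ℝ) ^ 3 * B₃ * ε₁ ≤ α →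
      ‖Bf i V U₀‖ < 2 * ((3 : ℝ) * i.1.1.L) * ((L : ℝ) ^ 3 * ε₁))
    -- (i) CHART-112, displayed
    (hChart : ∀ (i : Idx L) (ε₁ : ℝ) (V : GaugeField (i.1.1.P i.1.2.1) 0 (Matrix.specialUnitaryGroup (Fin 2) ℂ))
      (U₀ : GaugeField (i.1.1.P i.1.2.2) 0 (Matrix.specialUnitaryGroup (Fin 2) ℂ)), 0 < ε₁ → PlaqSmall ε₁ V →
      RegPr i.1.1 i.1.2.1 i.1.2.2 ((L : ℝ) ^ 3 * B₃ * ε₁) U₀ → CloseAvg i.1.1 i.1.2.1 i.1.2.2 i.2.2.le ((L : ℝ) ^ 3 * ε₁) V U₀ → (L : ℝ) ^ 3 * B₃ * ε₁ ≤ α →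
      ∀ A₁ : Space115 (i.1.1.L : ℝ) (((i.1.1.L : ℝ)⁻¹) ^ (i.1.2.2 - i.1.2.1)) (fun _ : Bond (i.1.1.P i.1.2.2).d (Pd i) => i.1.2.2 - i.1.2.1)
          (fun _ : Bond (i.1.1.P i.1.2.2).d (Pd i) × Fin (i.1.1.P i.1.2.2).d => i.1.2.2 - i.1.2.1) (nabla115 (((i.1.1.L : ℝ)⁻¹) ^ (i.1.2.2 - i.1.2.1)) (fun b : Bond (i.1.1.P i.1.2.2).d (Pd i) => unitsField (toUField U₀) ⟨(e i).symm b.1, b.2⟩)),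
        ‖A₁‖ < r → A₁ + 𝒢f i U₀ (Jcur (fun b : Bond (i.1.1.P i.1.2.2).d (Pd i) => unitsField (toUField U₀) ⟨(e i).symm b.1, b.2⟩)) + 𝒢f i U₀ (Wf i U₀ (A₁ + H₁f i U₀ (Bf i V U₀))) = 0 →
        ∃ X : PBond (i.1.1.P i.1.2.2) 0 → Matrix (Fin 2) (Fin 2) ℂ,
          (∀ b : PBond (i.1.1.P i.1.2.2) 0, (X b).IsHermitian ∧ Matrix.trace (X b) = 0) ∧
          nMax19 i.1.1 i.1.2.1 i.1.2.2 U₀ X ≤ M * (‖A₁‖ + ‖H₁f i U₀ (Bf i V U₀)‖) ∧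
          AvgCondPrintS i.1.1 i.1.2.1 i.1.2.2 i.2.2.le V U₀ X ∧ Lan i U₀ X ∧
          (∀ u : GaugeTransf (i.1.1.P i.1.2.2) 0 (Matrix.specialUnitaryGroup (Fin 2) ℂ), NormS i.1.1 i.1.2.1 i.1.2.2 i.2.2.le U₀ X (expHermField X) u →
            GaugeField.gaugeAct u (emb15 U₀ (expHermField X)) ∈ fibre i.1.1 ℰp i.1.2.1 i.1.2.2 i.2.2.le V →
            ∀ γ : ℝ → GaugeField (i.1.1.P i.1.2.2) 0 (Matrix.specialUnitaryGroup (Fin 2) ℂ), γ 0 = GaugeField.gaugeAct u (emb15 U₀ (expHermField X)) →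
              (∀ t, γ t ∈ fibre i.1.1 ℰp i.1.2.1 i.1.2.2 i.2.2.le V) →
              (∀ b, DifferentiableAt ℝ (fun t => ((γ t b : Matrix.specialUnitaryGroup (Fin 2) ℂ) : Matrix (Fin 2) (Fin 2) ℂ)) 0) →
                deriv (fun t => wilsonAction4 (γ t)) 0 = 0))
    -- (ii) the (γ)-input of ★w4's `growth142_T3`, displayed member-uniformly
    (hGrowth : ∀ (i : Idx L) (ε₁ ε₄ : ℝ) (V : GaugeField (i.1.1.P i.1.2.1) 0 (Matrix.specialUnitaryGroup (Fin 2) ℂ))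
      (U₀ : GaugeField (i.1.1.P i.1.2.2) 0 (Matrix.specialUnitaryGroup (Fin 2) ℂ)) (X : PBond (i.1.1.P i.1.2.2) 0 → Matrix (Fin 2) (Fin 2) ℂ)
      (u : GaugeTransf (i.1.1.P i.1.2.2) 0 (Matrix.specialUnitaryGroup (Fin 2) ℂ)) (W : GaugeField (i.1.1.P i.1.2.2) 0 (Matrix.specialUnitaryGroup (Fin 2) ℂ)),
      0 < ε₁ → ε₄ ≤ 1 / 4 → (L : ℝ) ^ 3 * B₃ * ε₁ ≤ ε₄ → PlaqSmall ε₁ V → RegPr i.1.1 i.1.2.1 i.1.2.2 ((L : ℝ) ^ 3 * B₃ * ε₁) U₀ →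
      CloseAvg i.1.1 i.1.2.1 i.1.2.2 i.2.2.le ((L : ℝ) ^ 3 * ε₁) V U₀ → (∀ b : PBond (i.1.1.P i.1.2.2) 0, (X b).IsHermitian ∧ Matrix.trace (X b) = 0) →
      nMax19 i.1.1 i.1.2.1 i.1.2.2 U₀ X < ε₄ → AvgCondPrintS i.1.1 i.1.2.1 i.1.2.2 i.2.2.le V U₀ X → Lan i U₀ X →
      NormS i.1.1 i.1.2.1 i.1.2.2 i.2.2.le U₀ X (expHermField X) u → W = GaugeField.gaugeAct u (emb15 U₀ (expHermField X)) →
      W ∈ fibre i.1.1 ℰp i.1.2.1 i.1.2.2 i.2.2.le V →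
      (∀ γ : ℝ → GaugeField (i.1.1.P i.1.2.2) 0 (Matrix.specialUnitaryGroup (Fin 2) ℂ), γ 0 = W → (∀ t, γ t ∈ fibre i.1.1 ℰp i.1.2.1 i.1.2.2 i.2.2.le V) →
        (∀ b, DifferentiableAt ℝ (fun t => ((γ t b : Matrix.specialUnitaryGroup (Fin 2) ℂ) : Matrix (Fin 2) (Fin 2) ℂ)) 0) →
          deriv (fun t => wilsonAction4 (γ t)) 0 = 0) →
      ∀ W' : GaugeField (i.1.1.P i.1.2.2) 0 (Matrix.specialUnitaryGroup (Fin 2) ℂ), W' ∈ regFibrePr i.1.1 i.1.2.1 i.1.2.2 i.2.2.le (178 * ε₄) V →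
        ∃ g : GaugeTransf (i.1.1.P i.1.2.2) 0 (Matrix.specialUnitaryGroup (Fin 2) ℂ), descTransf i.1.1 i.1.2.1 i.1.2.2 i.2.2.le g = (fun _ => 1) ∧
          (∑ b : PBond (i.1.1.P i.1.2.2) 0, ‖pertVar W (GaugeField.gaugeAct g W') b‖ ^ 2 ≤
            CP * ((i.1.1.L : ℝ) ^ (i.1.2.2 - i.1.2.1)) ^ 2 * ∑ p : Plaq (i.1.1.P i.1.2.2) 0,
              ‖((GaugeField.plaqHol (GaugeField.gaugeAct g W') p : Matrix.specialUnitaryGroup (Fin 2) ℂ) : Matrix (Fin 2) (Fin 2) ℂ)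
                  * star ((GaugeField.plaqHol W p : Matrix.specialUnitaryGroup (Fin 2) ℂ) : Matrix (Fin 2) (Fin 2) ℂ) - 1‖ ^ 2) ∧
          (-(θ * ∑ p : Plaq (i.1.1.P i.1.2.2) 0,
              ‖((GaugeField.plaqHol (GaugeField.gaugeAct g W') p : Matrix.specialUnitaryGroup (Fin 2) ℂ) : Matrix (Fin 2) (Fin 2) ℂ)
                  * star ((GaugeField.plaqHol W p : Matrix.specialUnitaryGroup (Fin 2) ℂ) : Matrix (Fin 2) (Fin 2) ℂ) - 1‖ ^ 2) -
              (cS * ε₄ * (((i.1.1.L : ℝ) ^ (i.1.2.2 - i.1.2.1)) ^ 2)⁻¹) * ∑ b : PBond (i.1.1.P i.1.2.2) 0, ‖pertVar W (GaugeField.gaugeAct g W') b‖ ^ 2 ≤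
            ∑ p : Plaq (i.1.1.P i.1.2.2) 0, (1 / 2) * ((((((GaugeField.plaqHol W p : Matrix.specialUnitaryGroup (Fin 2) ℂ) : Matrix (Fin 2) (Fin 2) ℂ)) - 1)ᴴ
              * (((((GaugeField.gaugeAct g W' ⟨p.src, p.μ⟩ : Matrix.specialUnitaryGroup (Fin 2) ℂ) : Matrix (Fin 2) (Fin 2) ℂ) * star (W ⟨p.src, p.μ⟩ : Matrix (Fin 2) (Fin 2) ℂ) - 1)
                  + (W ⟨p.src, p.μ⟩ : Matrix (Fin 2) (Fin 2) ℂ)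
                      * (((GaugeField.gaugeAct g W' ⟨p.src.shift p.μ, p.ν⟩ : Matrix.specialUnitaryGroup (Fin 2) ℂ) : Matrix (Fin 2) (Fin 2) ℂ) *
                          star (W ⟨p.src.shift p.μ, p.ν⟩ : Matrix (Fin 2) (Fin 2) ℂ) - 1)
                      * star (W ⟨p.src, p.μ⟩ : Matrix (Fin 2) (Fin 2) ℂ)
                  - ((W ⟨p.src, p.μ⟩ * W ⟨p.src.shift p.μ, p.ν⟩ * (W ⟨p.src.shift p.ν, p.μ⟩)⁻¹ : Matrix.specialUnitaryGroup (Fin 2) ℂ) :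
                        Matrix (Fin 2) (Fin 2) ℂ)
                      * (((GaugeField.gaugeAct g W' ⟨p.src.shift p.ν, p.μ⟩ : Matrix.specialUnitaryGroup (Fin 2) ℂ) : Matrix (Fin 2) (Fin 2) ℂ) *
                          star (W ⟨p.src.shift p.ν, p.μ⟩ : Matrix (Fin 2) (Fin 2) ℂ) - 1)
                      * star ((W ⟨p.src, p.μ⟩ * W ⟨p.src.shift p.μ, p.ν⟩ * (W ⟨p.src.shift p.ν, p.μ⟩)⁻¹ : Matrix.specialUnitaryGroup (Fin 2) ℂ) :
                        Matrix (Fin 2) (Fin 2) ℂ)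
                  - ((GaugeField.plaqHol W p : Matrix.specialUnitaryGroup (Fin 2) ℂ) : Matrix (Fin 2) (Fin 2) ℂ)
                      * (((GaugeField.gaugeAct g W' ⟨p.src, p.ν⟩ : Matrix.specialUnitaryGroup (Fin 2) ℂ) : Matrix (Fin 2) (Fin 2) ℂ) * star (W ⟨p.src, p.ν⟩ : Matrix (Fin 2) (Fin 2) ℂ) - 1)
                      * star ((GaugeField.plaqHol W p : Matrix.specialUnitaryGroup (Fin 2) ℂ) : Matrix (Fin 2) (Fin 2) ℂ))
                * ((GaugeField.plaqHol W p : Matrix.specialUnitaryGroup (Fin 2) ℂ) : Matrix (Fin 2) (Fin 2) ℂ))).trace).re)) :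
    ∃ B₀' a₄' : ℝ, 0 < B₀' ∧ 0 < a₄' ∧ ∀ (i : Idx L) (ε₁ ε₄ : ℝ), 0 < ε₁ → ε₄ ≤ a₄' → 2 * B₀' * (L : ℝ) ^ 3 * B₃ * ε₁ ≤ ε₄ →
        ∀ (V : GaugeField (i.1.1.P i.1.2.1) 0 (Matrix.specialUnitaryGroup (Fin 2) ℂ)) (U₀ : GaugeField (i.1.1.P i.1.2.2) 0 (Matrix.specialUnitaryGroup (Fin 2) ℂ)),
          PlaqSmall ε₁ V → RegPr i.1.1 i.1.2.1 i.1.2.2 ((L : ℝ) ^ 3 * B₃ * ε₁) U₀ → CloseAvg i.1.1 i.1.2.1 i.1.2.2 i.2.2.le ((L : ℝ) ^ 3 * ε₁) V U₀ →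
          ∃ X : PBond (i.1.1.P i.1.2.2) 0 → Matrix (Fin 2) (Fin 2) ℂ,
            nMax19 i.1.1 i.1.2.1 i.1.2.2 U₀ X < 3 * B₀' * (L : ℝ) ^ 3 * B₃ * ε₁ ∧ (∀ b : PBond (i.1.1.P i.1.2.2) 0, (X b).IsHermitian ∧ Matrix.trace (X b) = 0) ∧
            AvgCondPrintS i.1.1 i.1.2.1 i.1.2.2 i.2.2.le V U₀ X ∧ Lan i U₀ X ∧
            ∀ X' : PBond (i.1.1.P i.1.2.2) 0 → Matrix (Fin 2) (Fin 2) ℂ, nMax19 i.1.1 i.1.2.1 i.1.2.2 U₀ X' < ε₄ → (∀ b : PBond (i.1.1.P i.1.2.2) 0, (X' b).IsHermitian ∧ Matrix.trace (X' b) = 0) →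
              AvgCondPrint i.1.1 i.1.2.1 i.1.2.2 i.2.2.le V U₀ X' → IsLandauPrint i.1.1 i.1.2.1 i.1.2.2 U₀ X' →
                wilsonAction4 (emb15 U₀ (expHermField X)) ≤ wilsonAction4 (emb15 U₀ (expHermField X')) := by
  classical
  have hL0 : (0 : ℝ) < (L : ℝ) := by exact_mod_cast (show 0 < L by omega)
  have hLB : (0 : ℝ) < (L : ℝ) ^ 3 * B₃ := by
    have h3 : (0 : ℝ) < 3 * (L : ℝ) := by positivity
    exact mul_pos (by positivity) (h3.trans_le hB₃)
  -- the windowed letter `Bf′` (opaque through its defining equation)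
  obtain ⟨Bf', hBf'⟩ : ∃ Bf' : ∀ (i : Idx L), GaugeField (i.1.1.P i.1.2.1) 0 (Matrix.specialUnitaryGroup (Fin 2) ℂ) →
      GaugeField (i.1.1.P i.1.2.2) 0 (Matrix.specialUnitaryGroup (Fin 2) ℂ) → β i → Matrix (Fin 2) (Fin 2) ℂ,
      ∀ i V U₀, Bf' i V U₀ = if (∃ ε₁ : ℝ, 0 < ε₁ ∧ PlaqSmall ε₁ V ∧ RegPr i.1.1 i.1.2.1 i.1.2.2 ((L : ℝ) ^ 3 * B₃ * ε₁) U₀ ∧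
          CloseAvg i.1.1 i.1.2.1 i.1.2.2 i.2.2.le ((L : ℝ) ^ 3 * ε₁) V U₀ ∧ (L : ℝ) ^ 3 * B₃ * ε₁ ≤ α) then Bf i V U₀ else 0 :=
    ⟨_, fun _ _ _ => rfl⟩
  -- v1's UN-windowed (B20) row holds for `Bf′`
  have hB' : ∀ (i : Idx L) (ε₁ : ℝ) (V : GaugeField (i.1.1.P i.1.2.1) 0 (Matrix.specialUnitaryGroup (Fin 2) ℂ))
      (U₀ : GaugeField (i.1.1.P i.1.2.2) 0 (Matrix.specialUnitaryGroup (Fin 2) ℂ)), 0 < ε₁ → PlaqSmall ε₁ V →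
      RegPr i.1.1 i.1.2.1 i.1.2.2 ((L : ℝ) ^ 3 * B₃ * ε₁) U₀ → CloseAvg i.1.1 i.1.2.1 i.1.2.2 i.2.2.le ((L : ℝ) ^ 3 * ε₁) V U₀ →
      ‖Bf' i V U₀‖ < 2 * ((3 : ℝ) * i.1.1.L) * ((L : ℝ) ^ 3 * ε₁) := by
    intro i ε₁ V U₀ hε₁ hV hreg hclose
    have hFL' : (i.1.1.L : ℝ) = (L : ℝ) := by exact_mod_cast i.2.1
    have h6L : (0 : ℝ) < 2 * ((3 : ℝ) * i.1.1.L) := by rw [hFL']; positivity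
    by_cases hP : ∃ ε₁ : ℝ, 0 < ε₁ ∧ PlaqSmall ε₁ V ∧ RegPr i.1.1 i.1.2.1 i.1.2.2 ((L : ℝ) ^ 3 * B₃ * ε₁) U₀ ∧
        CloseAvg i.1.1 i.1.2.1 i.1.2.2 i.2.2.le ((L : ℝ) ^ 3 * ε₁) V U₀ ∧ (L : ℝ) ^ 3 * B₃ * ε₁ ≤ α
    · rw [hBf', if_pos hP]
      by_cases hw : (L : ℝ) ^ 3 * B₃ * ε₁ ≤ α
      · exact bound20 i ε₁ V U₀ hε₁ hV hreg hclose hw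
      · obtain ⟨ε₁', hε₁', hV', hreg', hclose', hw'⟩ := hP
        -- the witnessing `ε₁′` is admissible and `ε₁` is not, so `ε₁′ < ε₁`; the bound is monotone in `ε₁`
        have hlt : ε₁' < ε₁ := by
          by_contra hge
          exact hw ((mul_le_mul_of_nonneg_left (not_lt.mp hge) hLB.le).trans hw')
        calc ‖Bf i V U₀‖ < 2 * ((3 : ℝ) * i.1.1.L) * ((L : ℝ) ^ 3 * ε₁') := bound20 i ε₁' V U₀ hε₁' hV' hreg' hclose' hw'
          _ < 2 * ((3 : ℝ) * i.1.1.L) * ((L : ℝ) ^ 3 * ε₁) := by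
            apply mul_lt_mul_of_pos_left _ h6L
            exact mul_lt_mul_of_pos_left hlt (by positivity)
    · rw [hBf', if_neg hP, norm_zero]
      positivity
  -- v1's CHART-112 row holds for `Bf′`: its own window makes the `if` true
  have hChart' : ∀ (i : Idx L) (ε₁ : ℝ) (V : GaugeField (i.1.1.P i.1.2.1) 0 (Matrix.specialUnitaryGroup (Fin 2) ℂ))
      (U₀ : GaugeField (i.1.1.P i.1.2.2) 0 (Matrix.specialUnitaryGroup (Fin 2) ℂ)), 0 < ε₁ → PlaqSmall ε₁ V →
      RegPr i.1.1 i.1.2.1 i.1.2.2 ((L : ℝ) ^ 3 * B₃ * ε₁) U₀ → CloseAvg i.1.1 i.1.2.1 i.1.2.2 i.2.2.le ((L : ℝ) ^ 3 * ε₁) V U₀ → (L : ℝ) ^ 3 * B₃ * ε₁ ≤ α →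
      ∀ A₁ : Space115 (i.1.1.L : ℝ) (((i.1.1.L : ℝ)⁻¹) ^ (i.1.2.2 - i.1.2.1)) (fun _ : Bond (i.1.1.P i.1.2.2).d (Pd i) => i.1.2.2 - i.1.2.1)
          (fun _ : Bond (i.1.1.P i.1.2.2).d (Pd i) × Fin (i.1.1.P i.1.2.2).d => i.1.2.2 - i.1.2.1) (nabla115 (((i.1.1.L : ℝ)⁻¹) ^ (i.1.2.2 - i.1.2.1)) (fun b : Bond (i.1.1.P i.1.2.2).d (Pd i) => unitsField (toUField U₀) ⟨(e i).symm b.1, b.2⟩)),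
        ‖A₁‖ < r → A₁ + 𝒢f i U₀ (Jcur (fun b : Bond (i.1.1.P i.1.2.2).d (Pd i) => unitsField (toUField U₀) ⟨(e i).symm b.1, b.2⟩)) + 𝒢f i U₀ (Wf i U₀ (A₁ + H₁f i U₀ (Bf' i V U₀))) = 0 →
        ∃ X : PBond (i.1.1.P i.1.2.2) 0 → Matrix (Fin 2) (Fin 2) ℂ,
          (∀ b : PBond (i.1.1.P i.1.2.2) 0, (X b).IsHermitian ∧ Matrix.trace (X b) = 0) ∧
          nMax19 i.1.1 i.1.2.1 i.1.2.2 U₀ X ≤ M * (‖A₁‖ + ‖H₁f i U₀ (Bf' i V U₀)‖) ∧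
          AvgCondPrintS i.1.1 i.1.2.1 i.1.2.2 i.2.2.le V U₀ X ∧ Lan i U₀ X ∧
          (∀ u : GaugeTransf (i.1.1.P i.1.2.2) 0 (Matrix.specialUnitaryGroup (Fin 2) ℂ), NormS i.1.1 i.1.2.1 i.1.2.2 i.2.2.le U₀ X (expHermField X) u →
            GaugeField.gaugeAct u (emb15 U₀ (expHermField X)) ∈ fibre i.1.1 ℰp i.1.2.1 i.1.2.2 i.2.2.le V →
            ∀ γ : ℝ → GaugeField (i.1.1.P i.1.2.2) 0 (Matrix.specialUnitaryGroup (Fin 2) ℂ), γ 0 = GaugeField.gaugeAct u (emb15 U₀ (expHermField X)) →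
              (∀ t, γ t ∈ fibre i.1.1 ℰp i.1.2.1 i.1.2.2 i.2.2.le V) →
              (∀ b, DifferentiableAt ℝ (fun t => ((γ t b : Matrix.specialUnitaryGroup (Fin 2) ℂ) : Matrix (Fin 2) (Fin 2) ℂ)) 0) →
                deriv (fun t => wilsonAction4 (γ t)) 0 = 0) := by
    intro i ε₁ V U₀ hε₁ hV hreg hclose hαe
    have hP : ∃ ε₁ : ℝ, 0 < ε₁ ∧ PlaqSmall ε₁ V ∧ RegPr i.1.1 i.1.2.1 i.1.2.2 ((L : ℝ) ^ 3 * B₃ * ε₁) U₀ ∧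
        CloseAvg i.1.1 i.1.2.1 i.1.2.2 i.2.2.le ((L : ℝ) ^ 3 * ε₁) V U₀ ∧ (L : ℝ) ^ 3 * B₃ * ε₁ ≤ α := ⟨ε₁, hε₁, hV, hreg, hclose, hαe⟩
    rw [hBf', if_pos hP]
    exact hChart i ε₁ V U₀ hε₁ hV hreg hclose hαe
  exact Cmin_of_P6T3_chart_growth_pd_G hL hB₃ Lan Pd e he hB₀ hC₄ ha₃ hα hr hM hCP hθ hcS 𝒢f Wf β H₁f Bf' norm_G prop4 norm_H₁ hB' hChart' hGrowth

/-! ## §2 The REGISTERED stub text from the displayed rows, (B20) windowed -/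

/-! ## §2 The (α-S) DEPMAP of `stub_existenceMinimalOrbit` as one kernel statement -/

/-- ★★ **THE (α-S) DEPMAP OF `stub_existenceMinimalOrbit` AS ONE KERNEL STATEMENT, (B20) WINDOWED, (21)-LETTER GENERIC** (minimiser's (21) = `Lan L i U₀ X`, arbitrary) — the twin of ✓`stubEX_of_displayedRows_wS`: conclusion = the REGISTERED
text of `stub_existenceMinimalOrbit` (all `L > 1`, all `B₃ > 4`) VERBATIM; displayed rows N06(d = 3) `norm_G`∕`norm_H₁`, Prop. 4 `prop4`, (B20) `bound20` windowed at `B₃* = 3L`,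
CHART-112ˢ `hChart` ((20) conjunct `AvgCondPrintS`, E–L at the `NormS`-representatives), the (γ)-growth input `hGrowth` (antecedents `AvgCondPrintS X`, `NormS U₀ X (e^{iX}) u`,
`W = (e^{iX}U₀)^u ∈ 𝔅_k(V)`, E–L), the Thm 2 torus sockets `hThm2` (lit `Thm2TorusAt`, VERBATIM — COV keeps print's comb slice for the competitors, letter plan (J1)).  Composition:
✓`cov_of_thm2TorusAt` (COV), §1 (C-minˢ at `B₃* = 3L`), ✓`existenceMinimalOrbit_of_CminS_cov` (spine v2ˢ), ✓`existenceMinimalOrbit_allB₃_of_one` (all `B₃ > 4` from one).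
[cite: Balaban1985Variational, Prop. 7 p.299, Prop. 6 p.295, (112) p.294, (141)-(142) p.299; Balaban1985RegularSpaces, Thm 2 p.83, (1.37) p.82, (1.28)-(1.30) p.81] -/
theorem stubEX_of_displayedRows_wG
    [hFL : ∀ F : T3Family, Fact (0 < (F.L : ℝ))] [hFη : ∀ (F : T3Family) (k : ℕ), Fact (0 < ((F.L : ℝ)⁻¹) ^ k)]
    (Lan : ∀ (L : ℕ) (i : Idx L), GaugeField (i.1.1.P i.1.2.2) 0 (Matrix.specialUnitaryGroup (Fin 2) ℂ) → (PBond (i.1.1.P i.1.2.2) 0 → Matrix (Fin 2) (Fin 2) ℂ) → Prop)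
    (Pd : ∀ (L : ℕ) (i : Idx L), Fin (i.1.1.P i.1.2.2).d → ℕ) (e : ∀ (L : ℕ) (i : Idx L), Site (i.1.1.P i.1.2.2) 0 ≃ TSite (i.1.1.P i.1.2.2).d (Pd L i))
    (he : ∀ (L : ℕ) (i : Idx L) (x : Site (i.1.1.P i.1.2.2) 0) (μ : Fin (i.1.1.P i.1.2.2).d), e L i (x.shift μ) = B9Eq33CovDerivVector.shiftEquiv μ (e L i x))
    -- the constants, member-uniform at each `L` (print: «absolute constants depending on d and L only»)
    (B₀ C₄ a₃ α r M CP θ cS : ℕ → ℝ) (hB₀ : ∀ L, 1 < L → 0 < B₀ L) (hC₄ : ∀ L, 1 < L → 0 < C₄ L) (ha₃ : ∀ L, 1 < L → 0 < a₃ L)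
    (hα : ∀ L, 1 < L → 0 < α L) (hr : ∀ L, 1 < L → 0 < r L) (hM : ∀ L, 1 < L → 0 < M L) (hCP : ∀ L, 1 < L → 0 < CP L)
    (hθ : ∀ L, 1 < L → θ L < 1 / 2) (hcS : ∀ L, 1 < L → 0 ≤ cS L)
    -- the curved letters, OPAQUE
    (𝒢f : ∀ (L : ℕ) (i : Idx L) (U₀ : GaugeField (i.1.1.P i.1.2.2) 0 (Matrix.specialUnitaryGroup (Fin 2) ℂ)),
      NegSize (i.1.1.L : ℝ) (((i.1.1.L : ℝ)⁻¹) ^ (i.1.2.2 - i.1.2.1)) (fun _ : Bond (i.1.1.P i.1.2.2).d (Pd L i) => i.1.2.2 - i.1.2.1) 3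
          (Matrix (Fin 2) (Fin 2) ℂ) →L[ℂ]
        Space115 (i.1.1.L : ℝ) (((i.1.1.L : ℝ)⁻¹) ^ (i.1.2.2 - i.1.2.1)) (fun _ : Bond (i.1.1.P i.1.2.2).d (Pd L i) => i.1.2.2 - i.1.2.1)
          (fun _ : Bond (i.1.1.P i.1.2.2).d (Pd L i) × Fin (i.1.1.P i.1.2.2).d => i.1.2.2 - i.1.2.1) (nabla115 (((i.1.1.L : ℝ)⁻¹) ^ (i.1.2.2 - i.1.2.1)) (fun b : Bond (i.1.1.P i.1.2.2).d (Pd L i) => unitsField (toUField U₀) ⟨(e L i).symm b.1, b.2⟩)))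
    (Wf : ∀ (L : ℕ) (i : Idx L) (U₀ : GaugeField (i.1.1.P i.1.2.2) 0 (Matrix.specialUnitaryGroup (Fin 2) ℂ)),
      Space115 (i.1.1.L : ℝ) (((i.1.1.L : ℝ)⁻¹) ^ (i.1.2.2 - i.1.2.1)) (fun _ : Bond (i.1.1.P i.1.2.2).d (Pd L i) => i.1.2.2 - i.1.2.1)
          (fun _ : Bond (i.1.1.P i.1.2.2).d (Pd L i) × Fin (i.1.1.P i.1.2.2).d => i.1.2.2 - i.1.2.1) (nabla115 (((i.1.1.L : ℝ)⁻¹) ^ (i.1.2.2 - i.1.2.1)) (fun b : Bond (i.1.1.P i.1.2.2).d (Pd L i) => unitsField (toUField U₀) ⟨(e L i).symm b.1, b.2⟩)) →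
        NegSize (i.1.1.L : ℝ) (((i.1.1.L : ℝ)⁻¹) ^ (i.1.2.2 - i.1.2.1)) (fun _ : Bond (i.1.1.P i.1.2.2).d (Pd L i) => i.1.2.2 - i.1.2.1) 3 (Matrix (Fin 2) (Fin 2) ℂ))
    (β : ∀ L : ℕ, Idx L → Type) [∀ (L : ℕ) (i : Idx L), Fintype (β L i)]
    (H₁f : ∀ (L : ℕ) (i : Idx L) (U₀ : GaugeField (i.1.1.P i.1.2.2) 0 (Matrix.specialUnitaryGroup (Fin 2) ℂ)),
      (β L i → Matrix (Fin 2) (Fin 2) ℂ) →L[ℂ]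
        Space115 (i.1.1.L : ℝ) (((i.1.1.L : ℝ)⁻¹) ^ (i.1.2.2 - i.1.2.1)) (fun _ : Bond (i.1.1.P i.1.2.2).d (Pd L i) => i.1.2.2 - i.1.2.1)
          (fun _ : Bond (i.1.1.P i.1.2.2).d (Pd L i) × Fin (i.1.1.P i.1.2.2).d => i.1.2.2 - i.1.2.1) (nabla115 (((i.1.1.L : ℝ)⁻¹) ^ (i.1.2.2 - i.1.2.1)) (fun b : Bond (i.1.1.P i.1.2.2).d (Pd L i) => unitsField (toUField U₀) ⟨(e L i).symm b.1, b.2⟩)))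
    (Bf : ∀ (L : ℕ) (i : Idx L), GaugeField (i.1.1.P i.1.2.1) 0 (Matrix.specialUnitaryGroup (Fin 2) ℂ) → GaugeField (i.1.1.P i.1.2.2) 0 (Matrix.specialUnitaryGroup (Fin 2) ℂ) →
      β L i → Matrix (Fin 2) (Fin 2) ℂ)
    -- their displayed bounds (the `SectEDatum` fields at admissible backgrounds)
    (norm_G : ∀ (L : ℕ), 1 < L → ∀ (i : Idx L) (ρ : ℝ) (U₀ : GaugeField (i.1.1.P i.1.2.2) 0 (Matrix.specialUnitaryGroup (Fin 2) ℂ)),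
      RegPr i.1.1 i.1.2.1 i.1.2.2 ρ U₀ → ρ ≤ α L → ∀ f, ‖𝒢f L i U₀ f‖ ≤ B₀ L * ‖f‖)
    (prop4 : ∀ (L : ℕ), 1 < L → ∀ (i : Idx L) (ρ : ℝ) (U₀ : GaugeField (i.1.1.P i.1.2.2) 0 (Matrix.specialUnitaryGroup (Fin 2) ℂ)),
      RegPr i.1.1 i.1.2.1 i.1.2.2 ρ U₀ → ρ ≤ α L → QuadAnalytic (Wf L i U₀) (C₄ L) (a₃ L))
    (norm_H₁ : ∀ (L : ℕ), 1 < L → ∀ (i : Idx L) (ρ : ℝ) (U₀ : GaugeField (i.1.1.P i.1.2.2) 0 (Matrix.specialUnitaryGroup (Fin 2) ℂ)),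
      RegPr i.1.1 i.1.2.1 i.1.2.2 ρ U₀ → ρ ≤ α L → ∀ b, ‖H₁f L i U₀ b‖ ≤ B₀ L * ‖b‖)
    -- (B20), WINDOWED at `B₃* = 3L`: asked only on the admissible class `L³·(3L)·ε₁ ≤ α L`
    (bound20 : ∀ (L : ℕ), 1 < L → ∀ (i : Idx L) (ε₁ : ℝ) (V : GaugeField (i.1.1.P i.1.2.1) 0 (Matrix.specialUnitaryGroup (Fin 2) ℂ))
      (U₀ : GaugeField (i.1.1.P i.1.2.2) 0 (Matrix.specialUnitaryGroup (Fin 2) ℂ)), 0 < ε₁ → PlaqSmall ε₁ V →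
      RegPr i.1.1 i.1.2.1 i.1.2.2 ((L : ℝ) ^ 3 * (3 * (L : ℝ)) * ε₁) U₀ → CloseAvg i.1.1 i.1.2.1 i.1.2.2 i.2.2.le ((L : ℝ) ^ 3 * ε₁) V U₀ →
      (L : ℝ) ^ 3 * (3 * (L : ℝ)) * ε₁ ≤ α L →
      ‖Bf L i V U₀‖ < 2 * ((3 : ℝ) * i.1.1.L) * ((L : ℝ) ^ 3 * ε₁))
    -- (i) CHART-112, displayed
    (hChart : ∀ (L : ℕ), 1 < L → ∀ (i : Idx L) (ε₁ : ℝ) (V : GaugeField (i.1.1.P i.1.2.1) 0 (Matrix.specialUnitaryGroup (Fin 2) ℂ))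
      (U₀ : GaugeField (i.1.1.P i.1.2.2) 0 (Matrix.specialUnitaryGroup (Fin 2) ℂ)), 0 < ε₁ → PlaqSmall ε₁ V →
      RegPr i.1.1 i.1.2.1 i.1.2.2 ((L : ℝ) ^ 3 * (3 * (L : ℝ)) * ε₁) U₀ → CloseAvg i.1.1 i.1.2.1 i.1.2.2 i.2.2.le ((L : ℝ) ^ 3 * ε₁) V U₀ → (L : ℝ) ^ 3 * (3 * (L : ℝ)) * ε₁ ≤ α L →
      ∀ A₁ : Space115 (i.1.1.L : ℝ) (((i.1.1.L : ℝ)⁻¹) ^ (i.1.2.2 - i.1.2.1)) (fun _ : Bond (i.1.1.P i.1.2.2).d (Pd L i) => i.1.2.2 - i.1.2.1)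
          (fun _ : Bond (i.1.1.P i.1.2.2).d (Pd L i) × Fin (i.1.1.P i.1.2.2).d => i.1.2.2 - i.1.2.1) (nabla115 (((i.1.1.L : ℝ)⁻¹) ^ (i.1.2.2 - i.1.2.1)) (fun b : Bond (i.1.1.P i.1.2.2).d (Pd L i) => unitsField (toUField U₀) ⟨(e L i).symm b.1, b.2⟩)),
        ‖A₁‖ < r L → A₁ + 𝒢f L i U₀ (Jcur (fun b : Bond (i.1.1.P i.1.2.2).d (Pd L i) => unitsField (toUField U₀) ⟨(e L i).symm b.1, b.2⟩)) + 𝒢f L i U₀ (Wf L i U₀ (A₁ + H₁f L i U₀ (Bf L i V U₀))) = 0 →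
        ∃ X : PBond (i.1.1.P i.1.2.2) 0 → Matrix (Fin 2) (Fin 2) ℂ,
          (∀ b : PBond (i.1.1.P i.1.2.2) 0, (X b).IsHermitian ∧ Matrix.trace (X b) = 0) ∧
          nMax19 i.1.1 i.1.2.1 i.1.2.2 U₀ X ≤ M L * (‖A₁‖ + ‖H₁f L i U₀ (Bf L i V U₀)‖) ∧
          AvgCondPrintS i.1.1 i.1.2.1 i.1.2.2 i.2.2.le V U₀ X ∧ Lan L i U₀ X ∧
          (∀ u : GaugeTransf (i.1.1.P i.1.2.2) 0 (Matrix.specialUnitaryGroup (Fin 2) ℂ), NormS i.1.1 i.1.2.1 i.1.2.2 i.2.2.le U₀ X (expHermField X) u →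
            GaugeField.gaugeAct u (emb15 U₀ (expHermField X)) ∈ fibre i.1.1 ℰp i.1.2.1 i.1.2.2 i.2.2.le V →
            ∀ γ : ℝ → GaugeField (i.1.1.P i.1.2.2) 0 (Matrix.specialUnitaryGroup (Fin 2) ℂ), γ 0 = GaugeField.gaugeAct u (emb15 U₀ (expHermField X)) →
              (∀ t, γ t ∈ fibre i.1.1 ℰp i.1.2.1 i.1.2.2 i.2.2.le V) →
              (∀ b, DifferentiableAt ℝ (fun t => ((γ t b : Matrix.specialUnitaryGroup (Fin 2) ℂ) : Matrix (Fin 2) (Fin 2) ℂ)) 0) →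
                deriv (fun t => wilsonAction4 (γ t)) 0 = 0))
    -- (ii) the (γ)-input of ★w4's `growth142_T3`, displayed member-uniformly
    (hGrowth : ∀ (L : ℕ), 1 < L → ∀ (i : Idx L) (ε₁ ε₄ : ℝ) (V : GaugeField (i.1.1.P i.1.2.1) 0 (Matrix.specialUnitaryGroup (Fin 2) ℂ))
      (U₀ : GaugeField (i.1.1.P i.1.2.2) 0 (Matrix.specialUnitaryGroup (Fin 2) ℂ)) (X : PBond (i.1.1.P i.1.2.2) 0 → Matrix (Fin 2) (Fin 2) ℂ)
      (u : GaugeTransf (i.1.1.P i.1.2.2) 0 (Matrix.specialUnitaryGroup (Fin 2) ℂ)) (W : GaugeField (i.1.1.P i.1.2.2) 0 (Matrix.specialUnitaryGroup (Fin 2) ℂ)),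
      0 < ε₁ → ε₄ ≤ 1 / 4 → (L : ℝ) ^ 3 * (3 * (L : ℝ)) * ε₁ ≤ ε₄ → PlaqSmall ε₁ V → RegPr i.1.1 i.1.2.1 i.1.2.2 ((L : ℝ) ^ 3 * (3 * (L : ℝ)) * ε₁) U₀ →
      CloseAvg i.1.1 i.1.2.1 i.1.2.2 i.2.2.le ((L : ℝ) ^ 3 * ε₁) V U₀ → (∀ b : PBond (i.1.1.P i.1.2.2) 0, (X b).IsHermitian ∧ Matrix.trace (X b) = 0) →
      nMax19 i.1.1 i.1.2.1 i.1.2.2 U₀ X < ε₄ → AvgCondPrintS i.1.1 i.1.2.1 i.1.2.2 i.2.2.le V U₀ X → Lan L i U₀ X →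
      NormS i.1.1 i.1.2.1 i.1.2.2 i.2.2.le U₀ X (expHermField X) u → W = GaugeField.gaugeAct u (emb15 U₀ (expHermField X)) →
      W ∈ fibre i.1.1 ℰp i.1.2.1 i.1.2.2 i.2.2.le V →
      (∀ γ : ℝ → GaugeField (i.1.1.P i.1.2.2) 0 (Matrix.specialUnitaryGroup (Fin 2) ℂ), γ 0 = W → (∀ t, γ t ∈ fibre i.1.1 ℰp i.1.2.1 i.1.2.2 i.2.2.le V) →
        (∀ b, DifferentiableAt ℝ (fun t => ((γ t b : Matrix.specialUnitaryGroup (Fin 2) ℂ) : Matrix (Fin 2) (Fin 2) ℂ)) 0) →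
          deriv (fun t => wilsonAction4 (γ t)) 0 = 0) →
      ∀ W' : GaugeField (i.1.1.P i.1.2.2) 0 (Matrix.specialUnitaryGroup (Fin 2) ℂ), W' ∈ regFibrePr i.1.1 i.1.2.1 i.1.2.2 i.2.2.le (178 * ε₄) V →
        ∃ g : GaugeTransf (i.1.1.P i.1.2.2) 0 (Matrix.specialUnitaryGroup (Fin 2) ℂ), descTransf i.1.1 i.1.2.1 i.1.2.2 i.2.2.le g = (fun _ => 1) ∧
          (∑ b : PBond (i.1.1.P i.1.2.2) 0, ‖pertVar W (GaugeField.gaugeAct g W') b‖ ^ 2 ≤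
            CP L * ((i.1.1.L : ℝ) ^ (i.1.2.2 - i.1.2.1)) ^ 2 * ∑ p : Plaq (i.1.1.P i.1.2.2) 0,
              ‖((GaugeField.plaqHol (GaugeField.gaugeAct g W') p : Matrix.specialUnitaryGroup (Fin 2) ℂ) : Matrix (Fin 2) (Fin 2) ℂ)
                  * star ((GaugeField.plaqHol W p : Matrix.specialUnitaryGroup (Fin 2) ℂ) : Matrix (Fin 2) (Fin 2) ℂ) - 1‖ ^ 2) ∧
          (-(θ L * ∑ p : Plaq (i.1.1.P i.1.2.2) 0,
              ‖((GaugeField.plaqHol (GaugeField.gaugeAct g W') p : Matrix.specialUnitaryGroup (Fin 2) ℂ) : Matrix (Fin 2) (Fin 2) ℂ)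
                  * star ((GaugeField.plaqHol W p : Matrix.specialUnitaryGroup (Fin 2) ℂ) : Matrix (Fin 2) (Fin 2) ℂ) - 1‖ ^ 2) -
              (cS L * ε₄ * (((i.1.1.L : ℝ) ^ (i.1.2.2 - i.1.2.1)) ^ 2)⁻¹) * ∑ b : PBond (i.1.1.P i.1.2.2) 0, ‖pertVar W (GaugeField.gaugeAct g W') b‖ ^ 2 ≤
            ∑ p : Plaq (i.1.1.P i.1.2.2) 0, (1 / 2) * ((((((GaugeField.plaqHol W p : Matrix.specialUnitaryGroup (Fin 2) ℂ) : Matrix (Fin 2) (Fin 2) ℂ)) - 1)ᴴ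
              * (((((GaugeField.gaugeAct g W' ⟨p.src, p.μ⟩ : Matrix.specialUnitaryGroup (Fin 2) ℂ) : Matrix (Fin 2) (Fin 2) ℂ) * star (W ⟨p.src, p.μ⟩ : Matrix (Fin 2) (Fin 2) ℂ) - 1)
                  + (W ⟨p.src, p.μ⟩ : Matrix (Fin 2) (Fin 2) ℂ)
                      * (((GaugeField.gaugeAct g W' ⟨p.src.shift p.μ, p.ν⟩ : Matrix.specialUnitaryGroup (Fin 2) ℂ) : Matrix (Fin 2) (Fin 2) ℂ) *
                          star (W ⟨p.src.shift p.μ, p.ν⟩ : Matrix (Fin 2) (Fin 2) ℂ) - 1)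
                      * star (W ⟨p.src, p.μ⟩ : Matrix (Fin 2) (Fin 2) ℂ)
                  - ((W ⟨p.src, p.μ⟩ * W ⟨p.src.shift p.μ, p.ν⟩ * (W ⟨p.src.shift p.ν, p.μ⟩)⁻¹ : Matrix.specialUnitaryGroup (Fin 2) ℂ) :
                        Matrix (Fin 2) (Fin 2) ℂ)
                      * (((GaugeField.gaugeAct g W' ⟨p.src.shift p.ν, p.μ⟩ : Matrix.specialUnitaryGroup (Fin 2) ℂ) : Matrix (Fin 2) (Fin 2) ℂ) *
                          star (W ⟨p.src.shift p.ν, p.μ⟩ : Matrix (Fin 2) (Fin 2) ℂ) - 1)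
                      * star ((W ⟨p.src, p.μ⟩ * W ⟨p.src.shift p.μ, p.ν⟩ * (W ⟨p.src.shift p.ν, p.μ⟩)⁻¹ : Matrix.specialUnitaryGroup (Fin 2) ℂ) :
                        Matrix (Fin 2) (Fin 2) ℂ)
                  - ((GaugeField.plaqHol W p : Matrix.specialUnitaryGroup (Fin 2) ℂ) : Matrix (Fin 2) (Fin 2) ℂ)
                      * (((GaugeField.gaugeAct g W' ⟨p.src, p.ν⟩ : Matrix.specialUnitaryGroup (Fin 2) ℂ) : Matrix (Fin 2) (Fin 2) ℂ) * star (W ⟨p.src, p.ν⟩ : Matrix (Fin 2) (Fin 2) ℂ) - 1)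
                      * star ((GaugeField.plaqHol W p : Matrix.specialUnitaryGroup (Fin 2) ℂ) : Matrix (Fin 2) (Fin 2) ℂ))
                * ((GaugeField.plaqHol W p : Matrix.specialUnitaryGroup (Fin 2) ℂ) : Matrix (Fin 2) (Fin 2) ℂ))).trace).re))
    -- (T2) the [B8] Thm 2 torus sockets, one `(B₁, c₁)` per `L`
    (hThm2 : ∀ (L : ℕ), 1 < L → ∃ B₁ c₁ : ℝ, 0 < B₁ ∧ 0 < c₁ ∧ ∀ (F : T3Family), F.L = L → ∀ (n K : ℕ), n < K →
      ∃ (β₀ B₂ : ℝ) (len : B7Prop1Explicit.Site (F.P K).d → ℝ),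
        Thm2TorusAt (F.P K).L (K - n) ((((F.P K).sitesPerDir 0 : ℕ) : ℤ)) (eta F n K) β₀ B₁ B₂ c₁ len (specialUnitaryUnits (Fin 2)) (fun _ => True)) :
    ∀ (L : ℕ), 1 < L → ∀ (B₃ : ℝ), 4 < B₃ → ∃ a₁' O₁ : ℝ, 0 < a₁' ∧ 1 ≤ O₁ ∧
    ∀ (F : T3Family), F.L = L → ∀ (n K : ℕ) (hnK : n < K) (ε₁ : ℝ), 0 < ε₁ →
      ∀ V : GaugeField (F.P n) 0 (Matrix.specialUnitaryGroup (Fin 2) ℂ), PlaqSmall ε₁ V →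
        ∀ U₀ : GaugeField (F.P K) 0 (Matrix.specialUnitaryGroup (Fin 2) ℂ), RegPr F n K ((L : ℝ) ^ 3 * B₃ * ε₁) U₀ → U₀ ∈ fibre F ℰp n K hnK.le V →
          ε₁ ≤ a₁' → ∃ U ∈ regFibrePr F n K hnK.le (O₁ * (L : ℝ) ^ 3 * B₃ * ε₁) V,
            IsMinOn (fun W : GaugeField (F.P K) 0 (Matrix.specialUnitaryGroup (Fin 2) ℂ) => wilsonAction4 W)
              (regFibrePr F n K hnK.le (O₁ * (L : ℝ) ^ 3 * B₃ * ε₁) V) U := by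
  refine existenceMinimalOrbit_allB₃_of_one fun L hL => ?_
  have hL0 : (0 : ℝ) < (L : ℝ) := by exact_mod_cast (show 0 < L by omega)
  have hL2 : (2 : ℝ) ≤ (L : ℝ) := by exact_mod_cast (show 2 ≤ L by omega)
  have h3L4 : (4 : ℝ) < 3 * (L : ℝ) := by linarith
  obtain ⟨B₁, c₁, hB₁, hc₁, hT⟩ := hThm2 L hL
  have hCOV := cov_of_thm2TorusAt (L := L) (B₃ := 3 * (L : ℝ)) (by positivity) hB₁ hc₁ hT
  have hCmin := Cmin_of_P6T3_chart_growth_pd_wG hL (le_refl (3 * (L : ℝ))) (Lan L) (Pd L) (e L) (he L) (hB₀ L hL) (hC₄ L hL) (ha₃ L hL) (hα L hL) (hr L hL)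
    (hM L hL) (hCP L hL) (hθ L hL) (hcS L hL) (𝒢f L) (Wf L) (β L) (H₁f L) (Bf L) (norm_G L hL) (prop4 L hL) (norm_H₁ L hL) (bound20 L hL) (hChart L hL)
    (hGrowth L hL)
  obtain ⟨a₁', O₁, ha₁', hO₁, H⟩ := existenceMinimalOrbit_of_CminG_cov hL h3L4 (Lan L) hCmin hCOV
  exact ⟨3 * (L : ℝ), a₁', O₁, by positivity, ha₁', hO₁, H⟩

end Summit.QuantumFields.YangMills.Theorems.Prop7StubEXOfDisplayedRowsWG

end
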